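import Summits.QuantumFields.YangMills.Theorems.UnitScaleTiltProp7LaplaceAcFlatTransfer
import Summits.QuantumFields.YangMills.Theorems.UnitScaleTiltProp7AveragedFillings
import Summits.QuantumFields.YangMills.Theorems.UnitScaleTiltProp7CombFlatProjectorTransportT3
import HarnessLib

/-!
# Route `UnitScaleTilt`, crux K1 «MinimiserStabilityRegPr» (stmt-QuantumFields-19200) — route-R E′ (A′)-comb, ★★OWNER g29 RULING №18 (2): COMB-FLAT-COERCIVITY :=
# FILE B ∘ τ + isometry transfer (✓p695948) + (I3′) «δQ-SLICE».  FILE (I3′)-B: **THE SLICE ROW FROM A FILLING CERTIFICATE** — if the defect map `δ` (of record: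
# `y ↦ Q_kᶜ(1)(τy) − Q_k(1)y`) is, coarse bond by coarse bond, the pairing of `curl X` with a real 2-chain `S_c` of `ℓ²`-size `≤ A` and plaquette overlap `≤ M`, then
# px6 g5's displayed hypothesis (hv) of ✓`coercive_laplaceAc_one_of_sliceBound_conj` holds with **`ρ := a₀·(A·M)·L^{K−n}`**

Cell `ym3-torus`, width seat `ym-ust-19200-w4` (gen 8; (I3′) LOCATE-first taker per px6 g5 2026-08-29T04:36Z ∕ RULING №18 (2)).  THEOREMS ONLY (0 `def`, 0 `sorry`);
`--supports stmt-QuantumFields-19200`, count-neutral.  YM₃ on T³ is a ladder rung (R3), not the Clay problem; nothing here claims (I3′), COMB-FLAT-COERCIVITY, `norm_G₀ᶜ`, hcoS,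
E′, EX, the crux, d = 4 or the mass gap.

WHY.  ✓p695948 reduces comb-flat coercivity to ONE displayed analytic row (hv): `a·‖Q_kᶜ(1)(τy) − Q_k(1)y‖² ≤ ρ·(re⟨y, Δx(1)y⟩ + ‖R_S(1)D*(1)y‖²)` with
`a = a₀(c₀∕cB)ℓ³`, `ℓ = L^{K−n}`, and the KILL criterion of RULING №18 is «ρ K-dependent».  This seat's LOCATE `LOCATE-I3-COULOMB-w4g8.md` (sha16 720a4c12) says HOW (hv) holds
with `ρ` L-only: `δQ := Q_kᶜ(1)∘τ − Q_k(1)` is gradient-blind, so each weight 1-chain `ω_c` of `X ↦ (δQ X)(c)` is closed, hence (locally on the torus) the boundary of a 2-chain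
`S_c`, and `(δQ X)(c) = ⟨S_c, curl X⟩` (abelian lattice Stokes — in the tree as ✓`LinAvgFluxExact.rect_stokes`); the multiscale SMEARING of `δQ` makes `S_c` an average of thin
fillings, so `‖S_c‖²` is small (✓p696484 `sum_sq_avg_le_of_each`).  THIS FILE is the analytic half of that sentence, ONCE AND FOR ALL and for ANY map `δ`: given the filling
certificate `(S, A, M)` —
  (hS) `toL2B⁻¹(δ(toL2 X))(c) = Σ_p (S c p : ℂ) • curl 1 X p`,  (hA) `Σ_p (S c p)² ≤ A` for every coarse bond `c`,  (hM) `#{c : S c p ≠ 0} ≤ M` for every plaquette `p` —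
it proves `‖δ(toL2 X)‖² ≤ cB·(A·M)·Σ_p Σ_{jj′} |curl 1 X p|²_{jj′}` (§2–§3), reads the curl energy as `re⟨y, Δ^η(1) y⟩ = c₀η⁻²·Σ|curl|²` (✓`re_inner_DeltaEta_one`), and concludes
(hv) VERBATIM with `ρ := a₀·(A·M)·ℓ` (§4; `a·cB·η²∕c₀ = a₀·ℓ`; the `‖R_S D* y‖²` summand is not used and only added, being `≥ 0`).  So (I3′) IS NOW A COMBINATORIAL CERTIFICATE about
`δQ`: exhibit `S` with **`A·M·ℓ ≤ C_L`** (FILE F-c: `δQ`'s chains explicit over ✓p695582 ∕ px21 g6 (I2)-B `QTwS_one_sub_QTw_one_apply`, px6's (b1)∕(b2) `τ`, and the level sum;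
in MEAN units the LOCATE's count reads `A ≲ q̄²c₃·L²∕ℓ` — `N ~ ℓ³` translates of thin loops of area `~ ℓ²` with in-plane overlap `~ ℓ²`, divided by `ℓ²` for the mean — and `M ≤ m₀`).

WHAT IS PROVED (ns `…Theorems.Prop7SliceRowOfFilling`; `δ` ANY function between the two weighted `L²` carriers, `S` real):
* §1 `entry_sum_real_smul` + ★`norm_sq_entry_sum_smul_le` — the filling pairing ENTRYWISE: `|(Σ_p (S p : ℂ)•Y p)_{jj′}|² ≤ (Σ_p (S p)²)·Σ_{p : S p ≠ 0} |Y p_{jj′}|²` (✓p696484 (3));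
* §2 ★★`sum_norm_sq_le_of_filling` — the `ℓ²` BOUND over abstract finite index types: `Σ_c Σ_{jj′}|T c_{jj′}|² ≤ A·M·Σ_p Σ_{jj′}|Y p_{jj′}|²` when `T c = Σ_p (S c p : ℂ)•Y p`, (hA), (hM)
  (the exchange `Σ_c Σ_{p ∈ supp S c} = Σ_p #{c : S c p ≠ 0}`);
* §3 ★★`norm_sq_le_of_filling` — in the Hilbert letters: `‖δ(toL2 X)‖² ≤ cB·(A·M)·Σ_p Σ_{jj′}‖curl 1 X p‖²_{jj′}` (✓`norm_sq_toL2B`), and ★`sliceRow_of_filling`: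
  `a·‖δ y‖² ≤ (a·cB·(A·M)·ℓ²… )` — precisely `a·‖δ y‖² ≤ (a·cB·(A·M)∕(c₀·η⁻²… ))`, stated as `(a * cB * (A * M) * (eta F n K)² ∕ c₀) * re⟨y, Δ^η(1) y⟩`;
* §4 ★★★`sliceBound_conj_of_filling` — px6 g5's (hv) VERBATIM (slot `Δx` with `Δx 1 = Δ^η(1)`, any `τ`, `δ := y ↦ Q_kᶜ(1)(τ y) − Q_k(1) y`) with `ρ := a₀·(A·M)·(F.L)^{K−n}`, and
  `sliceBound_of_filling` (the same with `τ := id`, for ✓p694021's un-conjugated `coercive_laplaceAc_one_of_sliceBound`).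
HONEST SCOPE: inequalities and bookkeeping; the filling certificate for the ACTUAL `δQ` (F-c) is NOT constructed here, so (I3′), COMB-FLAT-COERCIVITY and A6ᶜ stay OPEN; `norm_G₀ᶜ`
([B9] Thm 3.3∕3.11 at curved `U₀`, N06) untouched.  Rung R3, not Clay; YM gap NOT proved.

References: T. Bałaban, CMP 99 (1985) 389–434 [Balaban1985BackgroundPropagators] ((3.26) p.395, Thm 3.11 p.416: the coercivity row served; (3.4), (3.11), (3.16): the norms);
CMP 95 (1984) 17–40 [Balaban1984PropagatorsI] ((1.9) p.19: lattice Stokes, the source of fillings); CMP 102 (1985) 277–309 [Balaban1985Variational] ((44)–(45) p.285: `Q_k` in A-units).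
-/

noncomputable section

open scoped InnerProductSpace ComplexConjugate Matrix.Norms.L2Operator BigOperators

namespace Summit.QuantumFields.YangMills.Theorems.Prop7SliceRowOfFilling

open Literature.MathematicalPhysics.QuantumFieldTheory.Balaban1983to89
open Literature.MathematicalPhysics.QuantumFieldTheory.Balaban1983to89.T3ContinuumYM3Torus
open T3SectALandauChart (eta eta_pos)
open LatticeFieldCalculus (curl)
open B9Eq311L2Pairing (WL2)
open B11Eq103H1Complex (SiteL2K BondL2K)
open Summit.QuantumFields.YangMills.Theorems.Prop7SectET3Transport (periodsT3)
open Summit.QuantumFields.YangMills.Theorems.Prop7SectET3HilbertLetters (W₂ toL2 toL2B DL2 DstarL2)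
open Summit.QuantumFields.YangMills.Theorems.Prop7SectET3GaugeProjector (RS)
open Summit.QuantumFields.YangMills.Theorems.Prop7SectET3WilsonHessian (DeltaEta)
open Summit.QuantumFields.YangMills.Theorems.Prop7SectET3CurvedPropagators (Qk)
open Summit.QuantumFields.YangMills.Theorems.Prop7SectET3CombLetters (Qkc)
open Summit.QuantumFields.YangMills.Theorems.Prop7LaplaceAFlatLetters (re_inner_DeltaEta_one norm_sq_toL2B)
open Summit.QuantumFields.YangMills.Theorems.Prop7AveragedFillings (norm_sq_sum_smul_le_of_support)

/-! ## §1 The filling pairing, entrywise -/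

/-- An entry of a real-weighted sum of matrices is the real-weighted sum of the entries. [folklore] -/
theorem entry_sum_real_smul {π : Type*} {m : Type*} (P : Finset π) (S : π → ℝ) (Y : π → Matrix m m ℂ) (i i' : m) :
    (∑ p ∈ P, (S p : ℂ) • Y p) i i' = ∑ p ∈ P, S p • Y p i i' := by
  rw [Matrix.sum_apply]
  exact Finset.sum_congr rfl fun p _ => by rw [Matrix.smul_apply, Complex.real_smul, smul_eq_mul]

/-- ★ **THE FILLING PAIRING, ENTRYWISE**: `|(Σ_p (S p : ℂ) • Y p)_{jj′}|² ≤ (Σ_p (S p)²) · Σ_{p : S p ≠ 0} |(Y p)_{jj′}|²` — Cauchy–Schwarz on the support of the filling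
(✓`Prop7AveragedFillings.norm_sq_sum_smul_le_of_support` at `W := ℂ`). [cite: Balaban1984PropagatorsI, (1.9) p.19] -/
theorem norm_sq_entry_sum_smul_le {π : Type*} {m : Type*} (P : Finset π) (S : π → ℝ) (Y : π → Matrix m m ℂ) (i i' : m) :
    ‖(∑ p ∈ P, (S p : ℂ) • Y p) i i'‖ ^ 2 ≤ (∑ p ∈ P, S p ^ 2) * ∑ p ∈ P.filter (fun p => S p ≠ 0), ‖Y p i i'‖ ^ 2 := by
  rw [entry_sum_real_smul]
  exact norm_sq_sum_smul_le_of_support P S (fun p => Y p i i')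

/-! ## §2 The `ℓ²` bound from a filling certificate (abstract finite index types) -/

/-- Exchanging the order of summation against a support count: `Σ_c Σ_{p ∈ P, S c p ≠ 0} e p = Σ_{p ∈ P} #{c : S c p ≠ 0} · e p`. [folklore] -/
theorem sum_sum_filter_eq_sum_card_mul {ι π : Type*} [Fintype ι] (P : Finset π) (S : ι → π → ℝ) (e : π → ℝ) :
    ∑ c, ∑ p ∈ P.filter (fun p => S c p ≠ 0), e p = ∑ p ∈ P, ((Finset.univ.filter fun c => S c p ≠ 0).card : ℝ) * e p := by
  classical
  calc ∑ c, ∑ p ∈ P.filter (fun p => S c p ≠ 0), e p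
      = ∑ c, ∑ p ∈ P, (if S c p ≠ 0 then e p else 0) := Finset.sum_congr rfl fun c _ => Finset.sum_filter _ _
    _ = ∑ p ∈ P, ∑ c, (if S c p ≠ 0 then e p else 0) := Finset.sum_comm
    _ = ∑ p ∈ P, ((Finset.univ.filter fun c => S c p ≠ 0).card : ℝ) * e p := by
        refine Finset.sum_congr rfl fun p _ => ?_
        rw [← Finset.sum_filter, Finset.sum_const, nsmul_eq_mul]

/-- ★★ **THE `ℓ²` BOUND FROM A FILLING CERTIFICATE.**  If `T c = Σ_p (S c p : ℂ) • Y p` for every `c`, each filling has `Σ_p (S c p)² ≤ A` (`A ≥ 0`), and at most `M` fillings meet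
any plaquette (`#{c : S c p ≠ 0} ≤ M`), then `Σ_c Σ_{jj′} |T c_{jj′}|² ≤ A·M·Σ_p Σ_{jj′} |Y p_{jj′}|²`. [cite: Balaban1984PropagatorsI, (1.9) p.19; Balaban1985BackgroundPropagators, (3.16) p.393] -/
theorem sum_norm_sq_le_of_filling {ι π : Type*} [Fintype ι] [Fintype π] {m : Type*} [Fintype m]
    (T : ι → Matrix m m ℂ) (S : ι → π → ℝ) (Y : π → Matrix m m ℂ) (hT : ∀ c, T c = ∑ p, (S c p : ℂ) • Y p)
    {A M : ℝ} (hA0 : 0 ≤ A) (hA : ∀ c, ∑ p, S c p ^ 2 ≤ A) (hM : ∀ p, ((Finset.univ.filter fun c => S c p ≠ 0).card : ℝ) ≤ M) :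
    ∑ c, ∑ i, ∑ i', ‖T c i i'‖ ^ 2 ≤ A * M * ∑ p, ∑ i, ∑ i', ‖Y p i i'‖ ^ 2 := by
  classical
  -- the entrywise energy of the field `Y` on a plaquette
  set e : π → ℝ := fun p => ∑ i, ∑ i', ‖Y p i i'‖ ^ 2 with he_def
  have he : ∀ p, 0 ≤ e p := fun p => Finset.sum_nonneg fun i _ => Finset.sum_nonneg fun i' _ => sq_nonneg _
  -- per coarse bond: `Σ_{jj′}|T c|² ≤ A · Σ_{p : S c p ≠ 0} e p`
  have hc : ∀ c, ∑ i, ∑ i', ‖T c i i'‖ ^ 2 ≤ A * ∑ p ∈ Finset.univ.filter (fun p => S c p ≠ 0), e p := by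
    intro c
    calc ∑ i, ∑ i', ‖T c i i'‖ ^ 2
        ≤ ∑ i, ∑ i', (∑ p, S c p ^ 2) * ∑ p ∈ Finset.univ.filter (fun p => S c p ≠ 0), ‖Y p i i'‖ ^ 2 := by
          refine Finset.sum_le_sum fun i _ => Finset.sum_le_sum fun i' _ => ?_
          rw [hT c]
          exact norm_sq_entry_sum_smul_le Finset.univ (S c) Y i i'
      _ = (∑ p, S c p ^ 2) * ∑ p ∈ Finset.univ.filter (fun p => S c p ≠ 0), e p := by
          simp only [he_def, ← Finset.mul_sum]
          congr 1
          exact (Finset.sum_congr rfl fun i _ => Finset.sum_comm).trans Finset.sum_comm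
      _ ≤ A * ∑ p ∈ Finset.univ.filter (fun p => S c p ≠ 0), e p :=
          mul_le_mul_of_nonneg_right (hA c) (Finset.sum_nonneg fun p _ => he p)
  calc ∑ c, ∑ i, ∑ i', ‖T c i i'‖ ^ 2
      ≤ ∑ c, A * ∑ p ∈ Finset.univ.filter (fun p => S c p ≠ 0), e p := Finset.sum_le_sum fun c _ => hc c
    _ = A * ∑ p, ((Finset.univ.filter fun c => S c p ≠ 0).card : ℝ) * e p := by
        rw [← Finset.mul_sum, sum_sum_filter_eq_sum_card_mul]
    _ ≤ A * ∑ p, M * e p := by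
        refine mul_le_mul_of_nonneg_left (Finset.sum_le_sum fun p _ => mul_le_mul_of_nonneg_right (hM p) (he p)) hA0
    _ = A * M * ∑ p, ∑ i, ∑ i', ‖Y p i i'‖ ^ 2 := by
        rw [← Finset.mul_sum, mul_assoc]

/-! ## §3 In the Hilbert letters of Sect. E: any map `δ` with a filling certificate -/

section Hilbert

variable {F : T3Family} {n K : ℕ} {c₀ cB : ℝ}

/-- ★★ **THE DEFECT NORM FROM A FILLING CERTIFICATE**: for ANY map `δ` from the fine weighted `L²` carrier to the coarse one, if `toL2B⁻¹(δ(toL2 X))(c) = Σ_p (S c p : ℂ) • curl 1 X p`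
with `Σ_p (S c p)² ≤ A` and `#{c : S c p ≠ 0} ≤ M`, then `‖δ(toL2 X)‖² ≤ cB·(A·M)·Σ_p Σ_{jj′} |curl 1 X p_{jj′}|²` (✓`norm_sq_toL2B` + §2).
[cite: Balaban1985BackgroundPropagators, (3.16) p.393, (3.26) p.395; Balaban1984PropagatorsI, (1.9) p.19] -/
theorem norm_sq_le_of_filling [Fact (0 < cB)]
    (δ : BondL2K ℂ 3 (periodsT3 F K) c₀ W₂ → WL2 ℂ (fun _ : PBond (F.P n) 0 => cB) W₂)
    (S : PBond (F.P n) 0 → Plaq (F.P K) 0 → ℝ)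
    (hS : ∀ (X : PBond (F.P K) 0 → Matrix (Fin 2) (Fin 2) ℂ) (c : PBond (F.P n) 0),
      (toL2B F n cB).symm (δ (toL2 F K c₀ X)) c = ∑ p : Plaq (F.P K) 0, (S c p : ℂ) • curl 1 X p)
    {A M : ℝ} (hA0 : 0 ≤ A) (hA : ∀ c, ∑ p, S c p ^ 2 ≤ A) (hM : ∀ p, ((Finset.univ.filter fun c => S c p ≠ 0).card : ℝ) ≤ M)
    (X : PBond (F.P K) 0 → Matrix (Fin 2) (Fin 2) ℂ) :
    ‖δ (toL2 F K c₀ X)‖ ^ 2 ≤ cB * (A * M) * ∑ p : Plaq (F.P K) 0, ∑ i, ∑ i', ‖curl 1 X p i i'‖ ^ 2 := by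
  have hcB : 0 < cB := Fact.out
  have hTB : δ (toL2 F K c₀ X) = toL2B F n cB ((toL2B F n cB).symm (δ (toL2 F K c₀ X))) := ((toL2B F n cB).apply_symm_apply _).symm
  rw [hTB, norm_sq_toL2B, mul_assoc]
  refine mul_le_mul_of_nonneg_left ?_ hcB.le
  exact sum_norm_sq_le_of_filling _ S (fun p => curl 1 X p) (hS X) hA0 hA hM

/-- ★ **THE SLICE ROW AGAINST THE WILSON HESSIAN AT THE FLAT MEMBER**: under the same certificate, for every `a ≥ 0` and every `y`,
`a·‖δ y‖² ≤ (a·cB·(A·M)·η²∕c₀) · re⟨y, Δ^η(1) y⟩` — the curl energy read through ✓`re_inner_DeltaEta_one` (`re⟨y, Δ^η(1)y⟩ = c₀η⁻²Σ|curl|²`).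
[cite: Balaban1985BackgroundPropagators, (3.4) p.391, (3.26) p.395; Balaban1985Variational, (44)–(45) p.285] -/
theorem sliceRow_of_filling [Fact (0 < c₀)] [Fact (0 < cB)]
    (δ : BondL2K ℂ 3 (periodsT3 F K) c₀ W₂ → WL2 ℂ (fun _ : PBond (F.P n) 0 => cB) W₂)
    (S : PBond (F.P n) 0 → Plaq (F.P K) 0 → ℝ)
    (hS : ∀ (X : PBond (F.P K) 0 → Matrix (Fin 2) (Fin 2) ℂ) (c : PBond (F.P n) 0),
      (toL2B F n cB).symm (δ (toL2 F K c₀ X)) c = ∑ p : Plaq (F.P K) 0, (S c p : ℂ) • curl 1 X p)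
    {A M : ℝ} (hA0 : 0 ≤ A) (hA : ∀ c, ∑ p, S c p ^ 2 ≤ A) (hM : ∀ p, ((Finset.univ.filter fun c => S c p ≠ 0).card : ℝ) ≤ M)
    {a : ℝ} (ha : 0 ≤ a) (y : BondL2K ℂ 3 (periodsT3 F K) c₀ W₂) :
    a * ‖δ y‖ ^ 2 ≤ (a * cB * (A * M) * (eta F n K) ^ 2 / c₀) * RCLike.re ⟪y, DeltaEta F n K c₀ 1 y⟫_ℂ := by
  have hc₀ : 0 < c₀ := Fact.out
  have hη : 0 < eta F n K := eta_pos F n K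
  obtain ⟨X, rfl⟩ : ∃ X, toL2 F K c₀ X = y := ⟨(toL2 F K c₀).symm y, (toL2 F K c₀).apply_symm_apply y⟩
  rw [re_inner_DeltaEta_one]
  have h1 := norm_sq_le_of_filling δ S hS hA0 hA hM X
  have hE : 0 ≤ ∑ p : Plaq (F.P K) 0, ∑ i, ∑ i', ‖curl 1 X p i i'‖ ^ 2 :=
    Finset.sum_nonneg fun p _ => Finset.sum_nonneg fun i _ => Finset.sum_nonneg fun i' _ => sq_nonneg _
  have hkey : (a * cB * (A * M) * (eta F n K) ^ 2 / c₀) * (c₀ * (eta F n K)⁻¹ ^ 2 * ∑ p : Plaq (F.P K) 0, ∑ i, ∑ i', ‖curl 1 X p i i'‖ ^ 2)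
      = a * (cB * (A * M) * ∑ p : Plaq (F.P K) 0, ∑ i, ∑ i', ‖curl 1 X p i i'‖ ^ 2) := by
    field_simp
  rw [hkey]
  exact mul_le_mul_of_nonneg_left h1 ha

end Hilbert

/-! ## §4 px6 g5's displayed hypothesis (hv), verbatim, from a filling certificate for `δQ := Q_kᶜ(1)∘τ − Q_k(1)` -/

section Row

variable {F : T3Family} {n K : ℕ} {c₀ : ℝ}

/-- ★★★ **(I3′) ⟸ A FILLING CERTIFICATE — THE SLICE ROW (hv) OF ✓`coercive_laplaceAc_one_of_sliceBound_conj`, VERBATIM.**  For every slot `Δx` with `Δx 1 = Δ^η(1)`, every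
map `τ` of the fine carrier, and every real filling `S` with `toL2B⁻¹(Q_kᶜ(1)(τ(toL2 X)) − Q_k(1)(toL2 X))(c) = Σ_p (S c p : ℂ) • curl 1 X p`, `Σ_p (S c p)² ≤ A` (`A ≥ 0`),
`#{c : S c p ≠ 0} ≤ M`: for every `a₀ ≥ 0` and every `y`,
`(a₀(c₀∕cB)ℓ³)·‖Q_kᶜ(1)(τy) − Q_k(1)y‖² ≤ ρ·(re⟨y, Δx 1 y⟩ + ‖R_S(1)D*(1)y‖²)` with **`ρ := a₀·(A·M)·L^{K−n}`** (`ℓ = L^{K−n}`, `η = ℓ⁻¹`, `a·cB·η²∕c₀ = a₀ℓ`).  K-UNIFORMITY OF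
THE COMB-FLAT CONSTANT ⟺ a certificate with `A·M·ℓ ≤ C_L` (FILE F-c).  [cite: Balaban1985BackgroundPropagators, (3.26) p.395, Thm 3.11 p.416; Balaban1984PropagatorsI, (1.9) p.19] -/
theorem sliceBound_conj_of_filling {h : n ≤ K} {cB : ℝ} [Fact (0 < c₀)] [Fact (0 < cB)]
    (Δx : GaugeField (F.P K) 0 (Matrix.specialUnitaryGroup (Fin 2) ℂ) → (BondL2K ℂ 3 (periodsT3 F K) c₀ W₂ →ₗ[ℂ] BondL2K ℂ 3 (periodsT3 F K) c₀ W₂))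
    (hΔ : Δx 1 = (DeltaEta F n K c₀ 1 : BondL2K ℂ 3 (periodsT3 F K) c₀ W₂ →ₗ[ℂ] BondL2K ℂ 3 (periodsT3 F K) c₀ W₂))
    (τ : BondL2K ℂ 3 (periodsT3 F K) c₀ W₂ → BondL2K ℂ 3 (periodsT3 F K) c₀ W₂)
    (S : PBond (F.P n) 0 → Plaq (F.P K) 0 → ℝ)
    (hS : ∀ (X : PBond (F.P K) 0 → Matrix (Fin 2) (Fin 2) ℂ) (c : PBond (F.P n) 0),
      (toL2B F n cB).symm
          (Qkc F n K h c₀ cB (1 : GaugeField (F.P K) 0 (Matrix.specialUnitaryGroup (Fin 2) ℂ)) (τ (toL2 F K c₀ X))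
            - Qk F n K h c₀ cB (1 : GaugeField (F.P K) 0 (Matrix.specialUnitaryGroup (Fin 2) ℂ)) (toL2 F K c₀ X)) c
        = ∑ p : Plaq (F.P K) 0, (S c p : ℂ) • curl 1 X p)
    {A M : ℝ} (hA0 : 0 ≤ A) (hA : ∀ c, ∑ p, S c p ^ 2 ≤ A) (hM : ∀ p, ((Finset.univ.filter fun c => S c p ≠ 0).card : ℝ) ≤ M)
    {a₀ : ℝ} (ha₀ : 0 ≤ a₀) (y : BondL2K ℂ 3 (periodsT3 F K) c₀ W₂) :
    (a₀ * (c₀ / cB) * ((F.L : ℝ) ^ (K - n)) ^ 3)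
        * ‖Qkc F n K h c₀ cB (1 : GaugeField (F.P K) 0 (Matrix.specialUnitaryGroup (Fin 2) ℂ)) (τ y)
            - Qk F n K h c₀ cB (1 : GaugeField (F.P K) 0 (Matrix.specialUnitaryGroup (Fin 2) ℂ)) y‖ ^ 2
      ≤ (a₀ * (A * M) * (F.L : ℝ) ^ (K - n))
          * (RCLike.re ⟪y, Δx 1 y⟫_ℂ
              + ‖RS F n K h c₀ cB (1 : GaugeField (F.P K) 0 (Matrix.specialUnitaryGroup (Fin 2) ℂ))
                  (DstarL2 F n K c₀ (1 : GaugeField (F.P K) 0 (Matrix.specialUnitaryGroup (Fin 2) ℂ)) y)‖ ^ 2) := by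
  have hc₀ : 0 < c₀ := Fact.out
  have hcB : 0 < cB := Fact.out
  have hL : (0 : ℝ) < F.L := by exact_mod_cast lt_trans zero_lt_one F.hL.2
  have ha : 0 ≤ a₀ * (c₀ / cB) * ((F.L : ℝ) ^ (K - n)) ^ 3 := by positivity
  -- §3 for the map `δ := y ↦ Q_kᶜ(1)(τ y) − Q_k(1) y`
  have h1 := sliceRow_of_filling (n := n)
    (fun y => Qkc F n K h c₀ cB (1 : GaugeField (F.P K) 0 (Matrix.specialUnitaryGroup (Fin 2) ℂ)) (τ y)
      - Qk F n K h c₀ cB (1 : GaugeField (F.P K) 0 (Matrix.specialUnitaryGroup (Fin 2) ℂ)) y) S hS hA0 hA hM ha y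
  -- the constant: `a·cB·(A·M)·η²∕c₀ = a₀·(A·M)·ℓ`
  have hηℓ : eta F n K * (F.L : ℝ) ^ (K - n) = 1 := by
    rw [eta, inv_pow]
    exact inv_mul_cancel₀ (pow_ne_zero _ hL.ne')
  have hconst : a₀ * (c₀ / cB) * ((F.L : ℝ) ^ (K - n)) ^ 3 * cB * (A * M) * (eta F n K) ^ 2 / c₀ = a₀ * (A * M) * (F.L : ℝ) ^ (K - n) := by
    have hw : c₀ / cB * cB / c₀ = 1 := by field_simp
    calc a₀ * (c₀ / cB) * ((F.L : ℝ) ^ (K - n)) ^ 3 * cB * (A * M) * (eta F n K) ^ 2 / c₀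
        = a₀ * (A * M) * (F.L : ℝ) ^ (K - n) * (eta F n K * (F.L : ℝ) ^ (K - n)) ^ 2 * (c₀ / cB * cB / c₀) := by ring
      _ = a₀ * (A * M) * (F.L : ℝ) ^ (K - n) := by rw [hηℓ, hw]; ring
  rw [hconst] at h1
  -- the `‖R_S D* y‖²` summand is only added
  have hρ : 0 ≤ a₀ * (A * M) * (F.L : ℝ) ^ (K - n) := by
    have hM0 : 0 ≤ M := (Nat.cast_nonneg _).trans (hM ⟨default, ⟨0, by simp⟩, ⟨1, by simp⟩, Fin.mk_lt_mk.2 Nat.zero_lt_one⟩)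
    positivity
  have hre : RCLike.re ⟪y, DeltaEta F n K c₀ 1 y⟫_ℂ ≤ RCLike.re ⟪y, DeltaEta F n K c₀ 1 y⟫_ℂ
      + ‖RS F n K h c₀ cB (1 : GaugeField (F.P K) 0 (Matrix.specialUnitaryGroup (Fin 2) ℂ))
          (DstarL2 F n K c₀ (1 : GaugeField (F.P K) 0 (Matrix.specialUnitaryGroup (Fin 2) ℂ)) y)‖ ^ 2 :=
    le_add_of_nonneg_right (sq_nonneg _)
  have hslot : RCLike.re ⟪y, Δx 1 y⟫_ℂ = RCLike.re ⟪y, DeltaEta F n K c₀ 1 y⟫_ℂ := by rw [hΔ]; rfl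
  rw [hslot]
  exact h1.trans (mul_le_mul_of_nonneg_left hre hρ)

/-- The same for ✓p694021's un-conjugated row (`τ := id`): `(a₀(c₀∕cB)ℓ³)·‖Q_kᶜ(1)y − Q_k(1)y‖² ≤ (a₀·(A·M)·L^{K−n})·(re⟨y, Δx 1 y⟩ + ‖R_S(1)D*(1)y‖²)`.
[cite: Balaban1985BackgroundPropagators, (3.26) p.395, Thm 3.11 p.416] -/
theorem sliceBound_of_filling {h : n ≤ K} {cB : ℝ} [Fact (0 < c₀)] [Fact (0 < cB)]
    (Δx : GaugeField (F.P K) 0 (Matrix.specialUnitaryGroup (Fin 2) ℂ) → (BondL2K ℂ 3 (periodsT3 F K) c₀ W₂ →ₗ[ℂ] BondL2K ℂ 3 (periodsT3 F K) c₀ W₂))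
    (hΔ : Δx 1 = (DeltaEta F n K c₀ 1 : BondL2K ℂ 3 (periodsT3 F K) c₀ W₂ →ₗ[ℂ] BondL2K ℂ 3 (periodsT3 F K) c₀ W₂))
    (S : PBond (F.P n) 0 → Plaq (F.P K) 0 → ℝ)
    (hS : ∀ (X : PBond (F.P K) 0 → Matrix (Fin 2) (Fin 2) ℂ) (c : PBond (F.P n) 0),
      (toL2B F n cB).symm
          (Qkc F n K h c₀ cB (1 : GaugeField (F.P K) 0 (Matrix.specialUnitaryGroup (Fin 2) ℂ)) (toL2 F K c₀ X)
            - Qk F n K h c₀ cB (1 : GaugeField (F.P K) 0 (Matrix.specialUnitaryGroup (Fin 2) ℂ)) (toL2 F K c₀ X)) c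
        = ∑ p : Plaq (F.P K) 0, (S c p : ℂ) • curl 1 X p)
    {A M : ℝ} (hA0 : 0 ≤ A) (hA : ∀ c, ∑ p, S c p ^ 2 ≤ A) (hM : ∀ p, ((Finset.univ.filter fun c => S c p ≠ 0).card : ℝ) ≤ M)
    {a₀ : ℝ} (ha₀ : 0 ≤ a₀) (y : BondL2K ℂ 3 (periodsT3 F K) c₀ W₂) :
    (a₀ * (c₀ / cB) * ((F.L : ℝ) ^ (K - n)) ^ 3)
        * ‖Qkc F n K h c₀ cB (1 : GaugeField (F.P K) 0 (Matrix.specialUnitaryGroup (Fin 2) ℂ)) y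
            - Qk F n K h c₀ cB (1 : GaugeField (F.P K) 0 (Matrix.specialUnitaryGroup (Fin 2) ℂ)) y‖ ^ 2
      ≤ (a₀ * (A * M) * (F.L : ℝ) ^ (K - n))
          * (RCLike.re ⟪y, Δx 1 y⟫_ℂ
              + ‖RS F n K h c₀ cB (1 : GaugeField (F.P K) 0 (Matrix.specialUnitaryGroup (Fin 2) ℂ))
                  (DstarL2 F n K c₀ (1 : GaugeField (F.P K) 0 (Matrix.specialUnitaryGroup (Fin 2) ℂ)) y)‖ ^ 2) :=
  sliceBound_conj_of_filling Δx hΔ id S hS hA0 hA hM ha₀ y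

end Row

/-! ## §5 (v1.1) px13 g6's displayed row `hv` of ✓p698599 `coercive_laplaceAc_one_of_sliceBound_basePt`, verbatim, and the end-to-end knit:
## COMB-FLAT COERCIVITY FROM A FILLING CERTIFICATE -/

section BasePt

variable {F : T3Family} {n K : ℕ} {c₀ : ℝ}

open Summit.QuantumFields.YangMills.Theorems.Prop7SPrint (basePt)
open Summit.QuantumFields.YangMills.Theorems.Prop7SectET3CombLetters (laplaceAc)
open Summit.QuantumFields.YangMills.Theorems.Prop7CombFlatProjectorTransport (coercive_laplaceAc_one_of_sliceBound_basePt)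

/-- ★★★ **(I3′) ⟸ A FILLING CERTIFICATE, IN THE LETTERS OF RECORD** (★★OWNER g29 05:14:30Z: Stage B = px13 g6 ✓p698599).  The SINGLE displayed row `hv` of
✓`coercive_laplaceAc_one_of_sliceBound_basePt` — `τ` = the carrier translation by `−basePt` (`X ↦ (b ↦ X (b.translate (−basePt)))`), quantified over the carrier field `X` — from a
real filling `S` of the defect `X ↦ toL2B⁻¹(Q_kᶜ(1)(toL2 (X ∘ translate(−basePt))) − Q_k(1)(toL2 X))` with `Σ_p (S c p)² ≤ A` (`A ≥ 0`), `#{c : S c p ≠ 0} ≤ M`: **`hv` holds with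
`ρ := a₀·(A·M)·L^{K−n}`**. [cite: Balaban1985BackgroundPropagators, (3.26) p.395, Thm 3.11 p.416; Balaban1984PropagatorsI, (1.9) p.19] -/
theorem sliceBound_basePt_of_filling {h : n ≤ K} {cB : ℝ} [Fact (0 < c₀)] [Fact (0 < cB)]
    (Δx : GaugeField (F.P K) 0 (Matrix.specialUnitaryGroup (Fin 2) ℂ) → (BondL2K ℂ 3 (periodsT3 F K) c₀ W₂ →ₗ[ℂ] BondL2K ℂ 3 (periodsT3 F K) c₀ W₂))
    (hΔ : Δx 1 = (DeltaEta F n K c₀ 1 : BondL2K ℂ 3 (periodsT3 F K) c₀ W₂ →ₗ[ℂ] BondL2K ℂ 3 (periodsT3 F K) c₀ W₂))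
    (S : PBond (F.P n) 0 → Plaq (F.P K) 0 → ℝ)
    (hS : ∀ (X : PBond (F.P K) 0 → Matrix (Fin 2) (Fin 2) ℂ) (c : PBond (F.P n) 0),
      (toL2B F n cB).symm
          (Qkc F n K h c₀ cB (1 : GaugeField (F.P K) 0 (Matrix.specialUnitaryGroup (Fin 2) ℂ)) (toL2 F K c₀ (fun b => X (b.translate (-basePt F n K))))
            - Qk F n K h c₀ cB (1 : GaugeField (F.P K) 0 (Matrix.specialUnitaryGroup (Fin 2) ℂ)) (toL2 F K c₀ X)) c
        = ∑ p : Plaq (F.P K) 0, (S c p : ℂ) • curl 1 X p)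
    {A M : ℝ} (hA0 : 0 ≤ A) (hA : ∀ c, ∑ p, S c p ^ 2 ≤ A) (hM : ∀ p, ((Finset.univ.filter fun c => S c p ≠ 0).card : ℝ) ≤ M)
    {a₀ : ℝ} (ha₀ : 0 ≤ a₀) (X : PBond (F.P K) 0 → Matrix (Fin 2) (Fin 2) ℂ) :
    (a₀ * (c₀ / cB) * ((F.L : ℝ) ^ (K - n)) ^ 3)
        * ‖Qkc F n K h c₀ cB (1 : GaugeField (F.P K) 0 (Matrix.specialUnitaryGroup (Fin 2) ℂ)) (toL2 F K c₀ (fun b => X (b.translate (-basePt F n K))))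
            - Qk F n K h c₀ cB (1 : GaugeField (F.P K) 0 (Matrix.specialUnitaryGroup (Fin 2) ℂ)) (toL2 F K c₀ X)‖ ^ 2
      ≤ (a₀ * (A * M) * (F.L : ℝ) ^ (K - n))
          * (RCLike.re ⟪toL2 F K c₀ X, Δx 1 (toL2 F K c₀ X)⟫_ℂ
              + ‖RS F n K h c₀ cB (1 : GaugeField (F.P K) 0 (Matrix.specialUnitaryGroup (Fin 2) ℂ))
                  (DstarL2 F n K c₀ (1 : GaugeField (F.P K) 0 (Matrix.specialUnitaryGroup (Fin 2) ℂ)) (toL2 F K c₀ X))‖ ^ 2) := by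
  -- the carrier translation as a map of the Hilbert carrier
  set τ : BondL2K ℂ 3 (periodsT3 F K) c₀ W₂ → BondL2K ℂ 3 (periodsT3 F K) c₀ W₂ :=
    fun y => toL2 F K c₀ (fun b => (toL2 F K c₀).symm y (b.translate (-basePt F n K))) with hτ_def
  have hτ : ∀ Y : PBond (F.P K) 0 → Matrix (Fin 2) (Fin 2) ℂ, τ (toL2 F K c₀ Y) = toL2 F K c₀ (fun b => Y (b.translate (-basePt F n K))) := fun Y => by
    simp only [hτ_def, LinearEquiv.symm_apply_apply]
  have hS' : ∀ (Y : PBond (F.P K) 0 → Matrix (Fin 2) (Fin 2) ℂ) (c : PBond (F.P n) 0),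
      (toL2B F n cB).symm
          (Qkc F n K h c₀ cB (1 : GaugeField (F.P K) 0 (Matrix.specialUnitaryGroup (Fin 2) ℂ)) (τ (toL2 F K c₀ Y))
            - Qk F n K h c₀ cB (1 : GaugeField (F.P K) 0 (Matrix.specialUnitaryGroup (Fin 2) ℂ)) (toL2 F K c₀ Y)) c
        = ∑ p : Plaq (F.P K) 0, (S c p : ℂ) • curl 1 Y p := fun Y c => by rw [hτ Y]; exact hS Y c
  have h1 := sliceBound_conj_of_filling Δx hΔ τ S hS' hA0 hA hM ha₀ (toL2 F K c₀ X)
  rwa [hτ X] at h1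

/-- ★★★ **COMB-FLAT COERCIVITY FROM A FILLING CERTIFICATE — THE END-TO-END KNIT** (✓p698599 ∘ §5): for every `a₀ > 0`, every slot `Δx` with `Δx 1 = Δ^η(1)`, and every filling
certificate `(S, A, M)` of the translated defect as above, print's comb `Δ_a(1)` (`a = a₀(c₀∕cB)ℓ³`) is coercive at the flat member:
**`(1∕(4·Cst 3 a₀·(2 + 2·a₀(A·M)ℓ)))·‖y‖² ≤ re⟨y, Δ_aᶜ(1) y⟩`** — K-UNIFORM exactly when `A·M·ℓ ≤ C_L` (FILE F-c).  Nothing displayed but the certificate.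
[cite: Balaban1985BackgroundPropagators, (3.26) p.395, Thm 3.11 p.416; Balaban1984PropagatorsI, (1.9) p.19] -/
theorem coercive_laplaceAc_one_of_filling {h : n ≤ K} {cB : ℝ} [Fact (0 < c₀)] [Fact (0 < cB)] {a₀ : ℝ} (ha₀ : 0 < a₀)
    (Δx : GaugeField (F.P K) 0 (Matrix.specialUnitaryGroup (Fin 2) ℂ) → (BondL2K ℂ 3 (periodsT3 F K) c₀ W₂ →ₗ[ℂ] BondL2K ℂ 3 (periodsT3 F K) c₀ W₂))
    (hΔ : Δx 1 = (DeltaEta F n K c₀ 1 : BondL2K ℂ 3 (periodsT3 F K) c₀ W₂ →ₗ[ℂ] BondL2K ℂ 3 (periodsT3 F K) c₀ W₂))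
    (S : PBond (F.P n) 0 → Plaq (F.P K) 0 → ℝ)
    (hS : ∀ (X : PBond (F.P K) 0 → Matrix (Fin 2) (Fin 2) ℂ) (c : PBond (F.P n) 0),
      (toL2B F n cB).symm
          (Qkc F n K h c₀ cB (1 : GaugeField (F.P K) 0 (Matrix.specialUnitaryGroup (Fin 2) ℂ)) (toL2 F K c₀ (fun b => X (b.translate (-basePt F n K))))
            - Qk F n K h c₀ cB (1 : GaugeField (F.P K) 0 (Matrix.specialUnitaryGroup (Fin 2) ℂ)) (toL2 F K c₀ X)) c
        = ∑ p : Plaq (F.P K) 0, (S c p : ℂ) • curl 1 X p)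
    {A M : ℝ} (hA0 : 0 ≤ A) (hA : ∀ c, ∑ p, S c p ^ 2 ≤ A) (hM : ∀ p, ((Finset.univ.filter fun c => S c p ≠ 0).card : ℝ) ≤ M)
    (y : BondL2K ℂ 3 (periodsT3 F K) c₀ W₂) :
    (1 / (4 * B5Prop11Plancherel.Cst 3 a₀ * (2 + 2 * (a₀ * (A * M) * (F.L : ℝ) ^ (K - n))))) * ‖y‖ ^ 2
      ≤ RCLike.re ⟪y, laplaceAc F n K h c₀ cB (a₀ * (c₀ / cB) * ((F.L : ℝ) ^ (K - n)) ^ 3) Δx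
          (1 : GaugeField (F.P K) 0 (Matrix.specialUnitaryGroup (Fin 2) ℂ)) y⟫_ℂ := by
  have hM0 : 0 ≤ M := (Nat.cast_nonneg _).trans (hM ⟨default, ⟨0, by simp⟩, ⟨1, by simp⟩, Fin.mk_lt_mk.2 Nat.zero_lt_one⟩)
  have hρ : 0 ≤ a₀ * (A * M) * (F.L : ℝ) ^ (K - n) := by
    have hL : (0 : ℝ) < F.L := by exact_mod_cast lt_trans zero_lt_one F.hL.2
    have := ha₀.le
    positivity
  exact coercive_laplaceAc_one_of_sliceBound_basePt (n := n) ha₀ Δx hΔ hρ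
    (fun X => sliceBound_basePt_of_filling Δx hΔ S hS hA0 hA hM ha₀.le X) y

end BasePt

/-! ## §6 (v1.1) The defect read back on the route carriers: `toL2B⁻¹(Q_kᶜ(1)(toL2 X′) − Q_k(1)(toL2 X)) = η • (QTw 1 X′ − QTwS 1 X)` -/

section Carrier

variable {F : T3Family} {n K : ℕ} {c₀ : ℝ}

open Summit.QuantumFields.YangMills.Theorems.Prop7SPrint (basePt)
open Summit.QuantumFields.YangMills.Theorems.Prop7SymAvgTw (QTw)
open Summit.QuantumFields.YangMills.Theorems.Prop7SymAvgTwSym (QTwS)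
open Summit.QuantumFields.YangMills.Theorems.Prop7SectET3HilbertLetters (QL2 QL2_toL2)
open Summit.QuantumFields.YangMills.Theorems.Prop7SectET3CombLetters (QL2c QL2c_toL2)

/-- ★ **THE DEFECT ON THE CARRIERS**: for all carrier fields `X′`, `X` and every coarse bond `c`,
`toL2B⁻¹(Q_kᶜ(1)(toL2 X′) − Q_k(1)(toL2 X))(c) = η • ((QTw 1 X′)(c) − (QTwS 1 X)(c))` (`Q_kᶜ = η•toL2B∘QTw∘toL2⁻¹`, `Q_k = η•toL2B∘QTwS∘toL2⁻¹`, ✓`QL2c_toL2`, ✓`QL2_toL2`) — so the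
`(hS)` of §3–§5 is an identity about print's explicit flat averages `QTw 1` (px21 g6 ✓`QTw_one_eq_tube_sub_coarseGrad`) and `QTwS 1` (✓`QTwS_one_apply`), at `X′ := X ∘ translate(−basePt)`.
[cite: Balaban1985BackgroundPropagators, (3.14) p.393; Balaban1985Variational, (44)–(45) p.285] -/
theorem defect_toL2_apply {h : n ≤ K} {cB : ℝ} [Fact (0 < c₀)] [Fact (0 < cB)]
    (X' X : PBond (F.P K) 0 → Matrix (Fin 2) (Fin 2) ℂ) (c : PBond (F.P n) 0) :
    (toL2B F n cB).symm
        (Qkc F n K h c₀ cB (1 : GaugeField (F.P K) 0 (Matrix.specialUnitaryGroup (Fin 2) ℂ)) (toL2 F K c₀ X')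
          - Qk F n K h c₀ cB (1 : GaugeField (F.P K) 0 (Matrix.specialUnitaryGroup (Fin 2) ℂ)) (toL2 F K c₀ X)) c
      = (((eta F n K : ℝ) : ℂ)) • (QTw F n K h (1 : GaugeField (F.P K) 0 (Matrix.specialUnitaryGroup (Fin 2) ℂ)) X' c
          - QTwS F n K h (1 : GaugeField (F.P K) 0 (Matrix.specialUnitaryGroup (Fin 2) ℂ)) X c) := by
  rw [Qkc, Qk, LinearMap.smul_apply, LinearMap.smul_apply, QL2c_toL2, QL2_toL2, ← smul_sub, ← map_sub, ← map_smul,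
    LinearEquiv.symm_apply_apply]
  rfl

/-- The same as an identity of carrier fields: `toL2B⁻¹(Q_kᶜ(1)(toL2 X′) − Q_k(1)(toL2 X)) = η • (QTw 1 X′ − QTwS 1 X)`. [cite: Balaban1985BackgroundPropagators, (3.14) p.393] -/
theorem defect_toL2 {h : n ≤ K} {cB : ℝ} [Fact (0 < c₀)] [Fact (0 < cB)]
    (X' X : PBond (F.P K) 0 → Matrix (Fin 2) (Fin 2) ℂ) :
    (toL2B F n cB).symm
        (Qkc F n K h c₀ cB (1 : GaugeField (F.P K) 0 (Matrix.specialUnitaryGroup (Fin 2) ℂ)) (toL2 F K c₀ X')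
          - Qk F n K h c₀ cB (1 : GaugeField (F.P K) 0 (Matrix.specialUnitaryGroup (Fin 2) ℂ)) (toL2 F K c₀ X))
      = (((eta F n K : ℝ) : ℂ)) • (QTw F n K h (1 : GaugeField (F.P K) 0 (Matrix.specialUnitaryGroup (Fin 2) ℂ)) X'
          - QTwS F n K h (1 : GaugeField (F.P K) 0 (Matrix.specialUnitaryGroup (Fin 2) ℂ)) X) := by
  funext c
  rw [defect_toL2_apply]
  rfl

/-- ★ **`(hS)` FROM A CARRIER IDENTITY**: if print's flat averages satisfy `η • ((QTw 1 (X ∘ translate(−basePt)))(c) − (QTwS 1 X)(c)) = Σ_p (S c p : ℂ) • curl 1 X p` for all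
`X`, `c`, then the hypothesis `(hS)` of §5 holds — the form in which F-c delivers the certificate. [cite: Balaban1985BackgroundPropagators, (3.14) p.393, Thm 3.11 p.416] -/
theorem hS_of_carrier {h : n ≤ K} {cB : ℝ} [Fact (0 < c₀)] [Fact (0 < cB)]
    (S : PBond (F.P n) 0 → Plaq (F.P K) 0 → ℝ)
    (hS : ∀ (X : PBond (F.P K) 0 → Matrix (Fin 2) (Fin 2) ℂ) (c : PBond (F.P n) 0),
      (((eta F n K : ℝ) : ℂ)) • (QTw F n K h (1 : GaugeField (F.P K) 0 (Matrix.specialUnitaryGroup (Fin 2) ℂ)) (fun b => X (b.translate (-basePt F n K))) c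
          - QTwS F n K h (1 : GaugeField (F.P K) 0 (Matrix.specialUnitaryGroup (Fin 2) ℂ)) X c)
        = ∑ p : Plaq (F.P K) 0, (S c p : ℂ) • curl 1 X p)
    (X : PBond (F.P K) 0 → Matrix (Fin 2) (Fin 2) ℂ) (c : PBond (F.P n) 0) :
    (toL2B F n cB).symm
        (Qkc F n K h c₀ cB (1 : GaugeField (F.P K) 0 (Matrix.specialUnitaryGroup (Fin 2) ℂ)) (toL2 F K c₀ (fun b => X (b.translate (-basePt F n K))))
          - Qk F n K h c₀ cB (1 : GaugeField (F.P K) 0 (Matrix.specialUnitaryGroup (Fin 2) ℂ)) (toL2 F K c₀ X)) c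
      = ∑ p : Plaq (F.P K) 0, (S c p : ℂ) • curl 1 X p := by
  rw [defect_toL2_apply]
  exact hS X c

end Carrier

end Summit.QuantumFields.YangMills.Theorems.Prop7SliceRowOfFilling

end
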